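import Summits.NavierStokesRegularity.NavierStokesRegularity.Theorems.LocalSineTubeDoorGenericDoor
import Summits.NavierStokesRegularity.NavierStokesRegularity.Theorems.ClockStretchingLawClockCeilingZoomScaling
import Summits.NavierStokesRegularity.NavierStokesRegularity.Theorems.PoloidalWindowDoorPoloidalWindowRigidityWindow
import Summits.NavierStokesRegularity.NavierStokesRegularity.Theorems.OddMorawetzMorawetzKillsTypeISelfSimilarRigidity
import Literature.Analysis.FluidPDE.SelfSimilar
import Literature.Analysis.FluidPDE.KatoLocalBoundedPicard
import Literature.Analysis.UnboundedOperators.HeatExtensionUniformTail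
import HarnessLib

/-!
# nsreg-p1 ROUND-17 door S18 «LocalConicalFinalStateDoor» (STAGED, HOLD) — K1 layer-2 child 2 «conical top identification»,
# PROVED — tree landing of the planner's sorry-free file

Pure limits (text of `ConicalTopIdentification` of nsreg-p1 `route-conical/bc/LocalPointZoomConicalTopSlice_birth.lean`,
verbatim): along a tree zoom at `(x₀,T)` with scales `λⱼ ↓ 0`, the physical cubic contact
`‖u(t,x) − u(T,x)‖ ≤ K₁(T−t)/‖x−x₀‖³ + C₁(T−t)` and the conical final trace `‖x−x₀‖‖u(T,x) − w₀(x−x₀)‖ → 0`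
(`w₀` (−1)-homogeneous) identify the top slice of the blow-up profile: `‖v(t,y) − ν⁻¹w₀(y)‖ ≤ (K₁/ν²)(−t)/‖y‖³`
for `t < 0`, `y ≠ 0`.  With the K1 skeleton's other child `ZoomWithUniformTopContact` (OPEN, M) this gives K1
`LocalPointZoomConicalTopSlice` (`LocalPointZoomConicalTopSlice_of`, proved in the skeleton).

Proof: nsreg-p1 g15 (`bc/LocalPointZoomConicalTopSlice_stub2.lean` 0d8806003d323962, farm rc 0 / 0 sorry), landed here
verbatim up to the namespace (planners do not write `Theorems/`).  Seat nsreg-p6 g10 (THEOREMS-ONLY door sequels,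
DIRECTOR-NS g8 #32 (2)/#36).  WHAT THIS IS NOT: not NS regularity; not K1 (its zoom child is open) nor K2; no route is
opened (S18 is staged, HOLD).
-/

noncomputable section

-- the summit and its single sub-problem share the name (CONVENTIONS §1)
set_option linter.dupNamespace false

namespace Summit.NavierStokesRegularity.NavierStokesRegularity.Theorems.LocalConicalFinalStateDoorTopIdentification

open MeasureTheory Set Function Filter Topology Metric
open scoped RealInnerProductSpace InnerProductSpace NNReal ENNReal
open Literature.Analysis Literature.Analysis.FluidPDE


/-- **K1 child 2 «conical top identification» (text verbatim), PROVED** (pure limits). -/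
theorem conicalTopIdentification :
    ∀ (ν T : ℝ) (u : ℝ → (EuclideanSpace ℝ (Fin 3)) → (EuclideanSpace ℝ (Fin 3))) (x₀ : (EuclideanSpace ℝ (Fin 3))) (ρ K₁ C₁ : ℝ) (v : ℝ → (EuclideanSpace ℝ (Fin 3)) → (EuclideanSpace ℝ (Fin 3))) (lam : ℕ → ℝ)
      (w₀ : (EuclideanSpace ℝ (Fin 3)) → (EuclideanSpace ℝ (Fin 3))),
    0 < ν → 0 < T → 0 < ρ →
    (∀ j, 0 < lam j) → Tendsto lam atTop (𝓝 0) →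
    (∀ s < 0, ∀ y : (EuclideanSpace ℝ (Fin 3)), Tendsto (fun j => (lam j / ν) • u (T + lam j ^ 2 * s / ν) (x₀ + lam j • y)) atTop (𝓝 (v s y))) →
    (∀ t ∈ Set.Ico 0 T, T - (ρ / 2) ^ 2 < t → ∀ x ∈ Metric.ball x₀ (ρ / 2), x ≠ x₀ →
        ‖u t x - u T x‖ ≤ K₁ * (T - t) / ‖x - x₀‖ ^ 3 + C₁ * (T - t)) →
    (∀ c : ℝ, 0 < c → ∀ z, w₀ (c • z) = c⁻¹ • w₀ z) →
    Tendsto (fun x => ‖x - x₀‖ * ‖u T x - w₀ (x - x₀)‖) (𝓝[≠] x₀) (𝓝 0) →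
    ∀ t < 0, ∀ y : (EuclideanSpace ℝ (Fin 3)), y ≠ 0 → ‖v t y - ν⁻¹ • w₀ y‖ ≤ K₁ / ν ^ 2 * (-t) / ‖y‖ ^ 3 := by
  intro ν T u x₀ ρ K₁ C₁ v lam w₀ hν hT hρ hlam hlam0 hzoom hphys hhom hcone t ht y hy
  have hyn : 0 < ‖y‖ := norm_pos_iff.2 hy
  have hnt : 0 < -t := neg_pos.2 ht
  -- the two sequences
  set a : ℕ → (EuclideanSpace ℝ (Fin 3)) := fun j => (lam j / ν) • u (T + lam j ^ 2 * t / ν) (x₀ + lam j • y) with ha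
  set b : ℕ → (EuclideanSpace ℝ (Fin 3)) := fun j => (lam j / ν) • u T (x₀ + lam j • y) with hb
  have ha_lim : Tendsto a atTop (𝓝 (v t y)) := hzoom t ht y
  -- ### `b j → ν⁻¹ w₀ y` by homogeneity and the conical trace
  have hxj : Tendsto (fun j => x₀ + lam j • y) atTop (𝓝[≠] x₀) := by
    refine tendsto_nhdsWithin_iff.2 ⟨?_, Eventually.of_forall fun j => ?_⟩
    · have h1 : Tendsto (fun j => x₀ + lam j • y) atTop (𝓝 (x₀ + (0 : ℝ) • y)) :=
        tendsto_const_nhds.add (hlam0.smul_const y)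
      simpa using h1
    · show x₀ + lam j • y ∈ ({x₀}ᶜ : Set (EuclideanSpace ℝ (Fin 3)))
      rw [mem_compl_singleton_iff, ne_eq, add_eq_left]
      exact smul_ne_zero (hlam j).ne' hy
  have hg : Tendsto (fun j => ‖(x₀ + lam j • y) - x₀‖ * ‖u T (x₀ + lam j • y) - w₀ ((x₀ + lam j • y) - x₀)‖)
      atTop (𝓝 0) := hcone.comp hxj
  have hb_err : ∀ j, ‖b j - ν⁻¹ • w₀ y‖ =
      (ν * ‖y‖)⁻¹ * (‖(x₀ + lam j • y) - x₀‖ * ‖u T (x₀ + lam j • y) - w₀ ((x₀ + lam j • y) - x₀)‖) := by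
    intro j
    have hl := hlam j
    have hw : ν⁻¹ • w₀ y = (lam j / ν) • w₀ (lam j • y) := by
      rw [hhom (lam j) hl y, smul_smul]
      congr 1
      field_simp
    rw [hw, hb, ← smul_sub, norm_smul, add_sub_cancel_left, norm_smul, Real.norm_of_nonneg hl.le,
      Real.norm_of_nonneg (by positivity : (0:ℝ) ≤ lam j / ν)]
    field_simp
  have hb_lim : Tendsto b atTop (𝓝 (ν⁻¹ • w₀ y)) := by
    rw [tendsto_iff_norm_sub_tendsto_zero]
    have h1 : Tendsto (fun j => (ν * ‖y‖)⁻¹ * (‖(x₀ + lam j • y) - x₀‖ *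
        ‖u T (x₀ + lam j • y) - w₀ ((x₀ + lam j • y) - x₀)‖)) atTop (𝓝 ((ν * ‖y‖)⁻¹ * 0)) :=
      hg.const_mul _
    rw [mul_zero] at h1
    exact h1.congr' (Eventually.of_forall fun j => (hb_err j).symm)
  -- ### the physical bound, rescaled: eventually `‖a j − b j‖ ≤ K₁(−t)/(ν²‖y‖³) + C₁ λⱼ³ (−t)/ν²`
  have hτ : Tendsto (fun j => lam j ^ 2 * (-t) / ν) atTop (𝓝 0) := by
    have h1 : Tendsto (fun j => lam j ^ 2 * (-t) / ν) atTop (𝓝 ((0:ℝ) ^ 2 * (-t) / ν)) :=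
      ((hlam0.pow 2).mul_const _).div_const _
    simpa using h1
  have hσ : Tendsto (fun j => lam j * ‖y‖) atTop (𝓝 0) := by
    simpa using hlam0.mul_const ‖y‖
  have hev : ∀ᶠ j in atTop, ‖a j - b j‖ ≤ K₁ / ν ^ 2 * (-t) / ‖y‖ ^ 3 + C₁ * lam j ^ 3 * (-t) / ν ^ 2 := by
    filter_upwards [hτ.eventually (Iio_mem_nhds (lt_min hT (by positivity : (0:ℝ) < (ρ / 2) ^ 2))),
      hσ.eventually (Iio_mem_nhds (by positivity : (0:ℝ) < ρ / 2))] with j hj1 hj2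
    have hl := hlam j
    have hj1' : lam j ^ 2 * (-t) / ν < T ∧ lam j ^ 2 * (-t) / ν < (ρ / 2) ^ 2 := by
      simpa [lt_min_iff] using hj1
    have hj2' : lam j * ‖y‖ < ρ / 2 := by simpa using hj2
    clear hj1 hj2
    obtain ⟨hj1a, hj1b⟩ := hj1'
    set tj : ℝ := T + lam j ^ 2 * t / ν with htj
    have hTt : T - tj = lam j ^ 2 * (-t) / ν := by rw [htj]; ring
    have htj1 : tj ∈ Set.Ico 0 T := ⟨by linarith [hj1a], by
      have : 0 < lam j ^ 2 * (-t) / ν := by positivity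
      linarith⟩
    have htj2 : T - (ρ / 2) ^ 2 < tj := by linarith [hj1b]
    have hxball : x₀ + lam j • y ∈ Metric.ball x₀ (ρ / 2) := by
      rw [Metric.mem_ball, dist_eq_norm, add_sub_cancel_left, norm_smul, Real.norm_of_nonneg hl.le]
      exact hj2'
    have hxne : x₀ + lam j • y ≠ x₀ := by
      rw [ne_eq, add_eq_left]; exact smul_ne_zero hl.ne' hy
    have hp := hphys tj htj1 htj2 (x₀ + lam j • y) hxball hxne
    rw [hTt, add_sub_cancel_left, norm_smul, Real.norm_of_nonneg hl.le] at hp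
    have hnorm : ‖a j - b j‖ = (lam j / ν) * ‖u tj (x₀ + lam j • y) - u T (x₀ + lam j • y)‖ := by
      rw [ha, hb]
      simp only []
      rw [← smul_sub, norm_smul, Real.norm_of_nonneg (by positivity : (0:ℝ) ≤ lam j / ν)]
    rw [hnorm]
    calc lam j / ν * ‖u tj (x₀ + lam j • y) - u T (x₀ + lam j • y)‖
        ≤ lam j / ν * (K₁ * (lam j ^ 2 * (-t) / ν) / (lam j * ‖y‖) ^ 3 + C₁ * (lam j ^ 2 * (-t) / ν)) :=
          mul_le_mul_of_nonneg_left hp (by positivity)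
      _ = K₁ / ν ^ 2 * (-t) / ‖y‖ ^ 3 + C₁ * lam j ^ 3 * (-t) / ν ^ 2 := by
          field_simp
  -- ### pass to the limit
  have hlhs : Tendsto (fun j => ‖a j - b j‖) atTop (𝓝 ‖v t y - ν⁻¹ • w₀ y‖) := (ha_lim.sub hb_lim).norm
  have hrhs : Tendsto (fun j => K₁ / ν ^ 2 * (-t) / ‖y‖ ^ 3 + C₁ * lam j ^ 3 * (-t) / ν ^ 2) atTop
      (𝓝 (K₁ / ν ^ 2 * (-t) / ‖y‖ ^ 3)) := by
    have h1 : Tendsto (fun j => K₁ / ν ^ 2 * (-t) / ‖y‖ ^ 3 + C₁ * lam j ^ 3 * (-t) / ν ^ 2) atTop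
        (𝓝 (K₁ / ν ^ 2 * (-t) / ‖y‖ ^ 3 + C₁ * (0:ℝ) ^ 3 * (-t) / ν ^ 2)) :=
      tendsto_const_nhds.add ((((hlam0.pow 3).const_mul C₁).mul_const _).div_const _)
    simpa using h1
  exact le_of_tendsto_of_tendsto hlhs hrhs hev


end Summit.NavierStokesRegularity.NavierStokesRegularity.Theorems.LocalConicalFinalStateDoorTopIdentification

end
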